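import Mathlib.Analysis.Calculus.IteratedDeriv.Defs
import Mathlib.Analysis.SpecialFunctions.Exp
import Mathlib.NumberTheory.Chebyshev
import Literature.NumberTheory.Transcendental.PeriodsWave0
import Literature.NumberTheory.Transcendental.ZetaLinearFormsCriterion
import HarnessLib

/-!
# Zudilin's linear forms in `1, ζ(5), ζ(7), ζ(9), ζ(11)` — the data of [Zudilin2004, Thm. 3]

Topic `Literature/NumberTheory/Transcendental`. This file fixes, as real DEFINITIONS, the objects
of W. Zudilin's proof that at least one of `ζ(5), ζ(7), ζ(9), ζ(11)` is irrational
(**periods.S20**, the named fact `Literature.NumberTheory.Transcendental.zudilin` of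
`PeriodsWave0.lean`; announced in [Zudilin2001], proved in [Zudilin2004, §8, Theorem 3]; exposition
[Fischler2004, §3.3]), and PROVES the final "gluing" step of that proof:
`Zudilin2004.zudilin_of_linearForms` derives `zudilin` from (i) the arithmetic of the linear forms
(Zudilin's Lemma 19 at the parameters of Theorem 3), (ii) their decay and non-vanishing
(Lemma 20 + the numerical value `C₀ = 227.58019641…`), (iii) the growth of the arithmetic
correction factor `Φₙ` (the constant `403 − C₂ = 176.75055734…`), using the prime number theorem
for `D_N = lcm(1,…,N)` and the elementary criterion of `ZetaLinearFormsCriterion.lean`.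
Items (i)–(iii) are NOT asserted here (they are hypotheses of the gluing theorem, stated
explicitly below in the docstring of `zudilin_of_linearForms`); no named fact is introduced and the
file is sorry-free.

## The data ([Zudilin2004, §8, (8.2)–(8.9) with `r = 3`, `q = 13`, `η₀ = 91`,
`η₁ = η₂ = η₃ = 27`, `ηⱼ = 25 + j` (`4 ≤ j ≤ 13`), `h₀ = 91n+2`, `hⱼ = ηⱼ n + 1`]; in the variable
`k = t + h₁ = t + 27n + 1` of [Fischler2004, §3.3])

* `Zudilin2004.R n k` — the very-well-poised rational function
  `Rₙ(k) = (∏_{u=1}^{10} ((13+2u)n)! / (27n)!⁶) · (37n+2k) · (k-27n)₂₇ₙ³ (k+37n+1)₂₇ₙ³ /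
  ∏_{u=1}^{10} (k+(12-u)n)_{(13+2u)n+1}` ([Fischler2004, §3.3, display]; = Zudilin's normalised
  `R(t)` of (8.7) times the well-poised factor `h₀ + 2t = 37n + 2k` of (8.2)), written with the
  Pochhammer symbols expanded into finite products, over any field (used at `ℝ`; the same
  expression over `ℂ` is its complex continuation).
* `Zudilin2004.S n = ½ ∑_{k ≥ 1} Rₙ''(k)` — the linear form
  (`F(h) = (1/(r-1)!) ∑_{t ≥ 1-h₁} R^{(r-1)}(t)` of (8.6); `S_n(1)` of [Fischler2004, §3.3]).
* `Zudilin2004.nu n k p = ν_{k,p}` and `Zudilin2004.nuMin n p = ν_p = min_{h₄ ≤ k ≤ h₀-h₄} ν_{k,p}`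
  — the exponents (8.9), and `Zudilin2004.Phi n = Φ = ∏_{√h₀ < p ≤ m₁₀} p^{ν_p}` — the integer
  (8.8) (`m₁₀ = 33n`).
* `Zudilin2004.D n = D_{35n}³ D_{34n} D_{33n}⁸` — the `lcm` factor of Lemma 19
  (`m₁ = 35n`, `m₂ = 34n`, `m₃ = ⋯ = m₁₀ = 33n`, `r = 3`).

## What is proved here

* `Zudilin2004.nu_nonneg`, `Zudilin2004.nu_le` (`0 ≤ ν_{k,p} ≤ 16`: each of the 16 brackets is of
  the form `⌊x+y⌋ - ⌊x⌋ - ⌊y⌋ ∈ {0,1}`), `Zudilin2004.nuMin_nonneg`, `Zudilin2004.Phi_pos`,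
  `Zudilin2004.D_pos`;
* `Zudilin2004.eventually_D_le_exp` — `D_{35n}³ D_{34n} D_{33n}⁸ ≤ e^{403.1 n}` for large `n`
  (prime number theorem; "`(d_{35n}³ d_{34n} d_{33n}⁸)^{1/n} → e^{403}`", [Fischler2004, §3.3]);
* `Zudilin2004.zudilin_of_linearForms` — the gluing step of [Zudilin2004, Thm. 3]:
  arithmetic (Lemma 19) + decay `|Sₙ| ≤ e^{-227.55 n}` + non-vanishing for infinitely many `n`
  (Lemma 20, `C₀ = 227.58019641…`) + `Φₙ ≥ e^{176.7 n}` (`403 - C₂`, `C₂ = 226.24944266…`)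
  imply `zudilin`, because `403.1 - 227.55 - 176.7 < 0`.

## Design notes

* `S n` is an infinite series (`tsum`); its summability (indeed `Rₙ''(k) = O(k⁻⁴)`) is part of the
  analytic input and is not needed for the gluing theorem, whose hypotheses speak about `S n`
  itself. For `k = 1, …, 27n` the summand vanishes (`Rₙ` has triple zeros there), so `S n` is also
  `½ ∑_{k > 27n} Rₙ''(k)`, the form in which it converges absolutely.
* The floor brackets of (8.9) are integer parts of possibly negative rationals; they are written
  `⌊(a : ℚ) / p⌋` (`Int.floor`), exactly as printed.
* `Φ` ranges over primes `p` with `p² > h₀ = 91n + 2` (i.e. `p > √h₀`) and `p ≤ 33n`.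

## References

* [Zudilin2001] W. Zudilin, *One of the numbers ζ(5), ζ(7), ζ(9), ζ(11) is irrational*, Russian
  Math. Surveys 56:4 (2001), 774–776.
* [Zudilin2004] W. Zudilin, *Arithmetic of linear forms involving odd zeta values*, J. Théor.
  Nombres Bordeaux 16 (2004), 251–291 (arXiv:math/0206176), §7 (Lemmas 15–18), §8 ((8.1)–(8.13),
  Lemmas 19–20, Prop. 5, Thm. 3).
* [Fischler2004] S. Fischler, *Irrationalité de valeurs de zêta*, Sém. Bourbaki exp. 910,
  Astérisque 294 (2004), §3.3.
-/

noncomputable section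

open Filter Topology Finset

namespace Literature.NumberTheory.Transcendental

namespace Zudilin2004

/-! ### The rational function and the linear forms -/

/-- The normalising constant `∏_{u=1}^{10} ((13+2u)n)! / (27n)!⁶`
(`= ∏_{j=r+1}^{q} (h₀-2hⱼ)! / ∏_{j=1}^{r} (hⱼ-1)!²` of [Zudilin2004, (8.6)] at the parameters of
Theorem 3). [cite: Zudilin2004, §8 (8.6) and Thm. 3] -/
def normConst (n : ℕ) : ℚ :=
  (∏ u ∈ Icc 1 10, (((13 + 2 * u) * n).factorial : ℚ)) / (((27 * n).factorial : ℚ)) ^ 6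

/-- **Zudilin's rational function** for Theorem 3, in Fischler's variable `k`:
`Rₙ(k) = normConst n · (37n + 2k) · (∏_{i=1}^{27n} (k-i))³ · (∏_{i=37n+1}^{64n} (k+i))³ /
∏_{u=1}^{10} ∏_{i=(12-u)n}^{(25+u)n} (k+i)`, i.e.
`(37n+2k) (k-27n)₂₇ₙ³ (k+37n+1)₂₇ₙ³ / ∏_u (k+(12-u)n)_{(13+2u)n+1}` times the normalising constant,
over an arbitrary field (`K = ℝ` for the linear forms, `K = ℂ` for their analysis). It has triple
zeros at `k = 1, …, 27n` and `k = -64n, …, -37n-1`, poles at `k = -35n, …, -2n`, satisfies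
`Rₙ(-37n-k) = -Rₙ(k)` and `Rₙ(k) = O(k⁻²)`. [cite: Fischler2004, §3.3]
[cite: Zudilin2004, §8 (8.2), (8.7), Thm. 3] -/
def R {K : Type*} [Field K] (n : ℕ) (k : K) : K :=
  (normConst n : K) * (37 * n + 2 * k) *
      (∏ i ∈ Icc 1 (27 * n), (k - i)) ^ 3 * (∏ i ∈ Icc (37 * n + 1) (64 * n), (k + i)) ^ 3 /
    ∏ u ∈ Icc 1 10, ∏ i ∈ Icc ((12 - u) * n) ((25 + u) * n), (k + i)

/-- **Zudilin's linear form** `Sₙ = ½ ∑_{k=1}^{∞} Rₙ''(k)` (the quantity `F(h)` of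
[Zudilin2004, (8.6)] with `r = 3`, i.e. `(1/(r-1)!) ∑_t R^{(r-1)}(t)`; `S_n(1)` in
[Fischler2004, §3.3]). By [Zudilin2004, Lemma 19] it is a rational linear form in
`1, ζ(5), ζ(7), ζ(9), ζ(11)`. The index `k : ℕ` of the `tsum` stands for the summation variable
`k + 1 ≥ 1`. [cite: Zudilin2004, §8 (8.4), (8.6)] -/
def S (n : ℕ) : ℝ :=
  (1 / 2) * ∑' k : ℕ, iteratedDeriv 2 (R n) ((k : ℝ) + 1)

/-! ### The arithmetic correction `Φ` and the `lcm` factor -/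

/-- The bracket sum `ν_{k,p}` of [Zudilin2004, (8.9)] at the parameters of Theorem 3
(`h₀ = 91n+2`, `h₁ = h₂ = h₃ = 27n+1`, `hⱼ = (25+j)n+1`, so `h₀ - 2hⱼ = (41-2j)n`):
`ν_{k,p} = 3(⌊(k-1)/p⌋ + ⌊(h₀-k-1)/p⌋ - ⌊(k-h₁)/p⌋ - ⌊(h₀-h₁-k)/p⌋ - 2⌊(h₁-1)/p⌋)
 + ∑_{j=4}^{13} (⌊(h₀-2hⱼ)/p⌋ - ⌊(k-hⱼ)/p⌋ - ⌊(h₀-hⱼ-k)/p⌋)` (integer parts of rationals).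
[cite: Zudilin2004, §8 (8.9)] -/
def nu (n k p : ℕ) : ℤ :=
  3 * (⌊((k : ℚ) - 1) / p⌋ + ⌊((91 * n + 2 : ℚ) - k - 1) / p⌋ - ⌊((k : ℚ) - (27 * n + 1)) / p⌋
        - ⌊((91 * n + 2 : ℚ) - (27 * n + 1) - k) / p⌋ - 2 * ⌊((27 * n : ℚ)) / p⌋) +
    ∑ j ∈ Icc (4 : ℕ) 13, (⌊(((41 : ℚ) - 2 * j) * n) / p⌋ - ⌊((k : ℚ) - ((25 + j) * n + 1)) / p⌋
        - ⌊((91 * n + 2 : ℚ) - ((25 + j) * n + 1) - k) / p⌋)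

/-- `ν_p = min_{h₄ ≤ k ≤ h₀ - h₄} ν_{k,p}` with `h₄ = 29n+1`, `h₀ - h₄ = 62n+1`.
[cite: Zudilin2004, §8 (8.9)] -/
def nuMin (n p : ℕ) : ℤ :=
  (Icc (29 * n + 1) (62 * n + 1)).inf' ⟨29 * n + 1, Finset.mem_Icc.2 ⟨le_rfl, by omega⟩⟩
    fun k => nu n k p

/-- **The integer `Φ = Φₙ`** of [Zudilin2004, (8.8)] at the parameters of Theorem 3:
`Φₙ = ∏ p^{ν_p}` over the primes `√(91n+2) < p ≤ 33n` (`m_{q-r} = m₁₀ = 33n`).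
[cite: Zudilin2004, §8 (8.8)] -/
def Phi (n : ℕ) : ℕ :=
  ∏ p ∈ (range (33 * n + 1)).filter (fun p => p.Prime ∧ 91 * n + 2 < p ^ 2), p ^ (nuMin n p).toNat

/-- The `lcm` factor `D_{35n}³ D_{34n} D_{33n}⁸` of [Zudilin2004, Lemma 19] at the parameters of
Theorem 3 (`D_N = lcm(1,…,N)` is `Nat.lcmUpto N`; `m₁ = 35n`, `m₂ = 34n`, `m₃ = ⋯ = m₁₀ = 33n`).
[cite: Zudilin2004, §8 Lemma 19 and proof of Thm. 3] -/
def D (n : ℕ) : ℕ :=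
  Nat.lcmUpto (35 * n) ^ 3 * Nat.lcmUpto (34 * n) * Nat.lcmUpto (33 * n) ^ 8

/-! ### Elementary properties -/

/-- `⌊x + y⌋ - ⌊x⌋ - ⌊y⌋ ∈ {0, 1}`, lower half. [folklore] -/
theorem floor_add_sub_nonneg (x y : ℚ) : 0 ≤ ⌊x + y⌋ - ⌊x⌋ - ⌊y⌋ := by
  have := Int.le_floor_add x y
  omega

/-- `⌊x + y⌋ - ⌊x⌋ - ⌊y⌋ ∈ {0, 1}`, upper half. [folklore] -/
theorem floor_add_sub_le_one (x y : ℚ) : ⌊x + y⌋ - ⌊x⌋ - ⌊y⌋ ≤ 1 := by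
  have := Int.le_floor_add_floor x y
  omega

/-- `ν_{k,p}` as a sum of sixteen brackets `⌊x+y⌋ - ⌊x⌋ - ⌊y⌋`. [cite: Zudilin2004, §8 (8.9)] -/
theorem nu_eq_brackets (n k p : ℕ) :
    nu n k p =
      3 * ((⌊((k : ℚ) - (27 * n + 1)) / p + (27 * n : ℚ) / p⌋ - ⌊((k : ℚ) - (27 * n + 1)) / p⌋
              - ⌊(27 * n : ℚ) / p⌋) +
           (⌊((91 * n + 2 : ℚ) - (27 * n + 1) - k) / p + (27 * n : ℚ) / p⌋
              - ⌊((91 * n + 2 : ℚ) - (27 * n + 1) - k) / p⌋ - ⌊(27 * n : ℚ) / p⌋)) +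
      ∑ j ∈ Icc (4 : ℕ) 13,
        (⌊((k : ℚ) - ((25 + j) * n + 1)) / p + ((91 * n + 2 : ℚ) - ((25 + j) * n + 1) - k) / p⌋
          - ⌊((k : ℚ) - ((25 + j) * n + 1)) / p⌋
          - ⌊((91 * n + 2 : ℚ) - ((25 + j) * n + 1) - k) / p⌋) := by
  unfold nu
  have h1 : ((k : ℚ) - (27 * n + 1)) / p + (27 * n : ℚ) / p = ((k : ℚ) - 1) / p := by ring
  have h2 : ((91 * n + 2 : ℚ) - (27 * n + 1) - k) / p + (27 * n : ℚ) / p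
      = ((91 * n + 2 : ℚ) - k - 1) / p := by ring
  have h3 : ∀ j : ℕ, ((k : ℚ) - ((25 + j) * n + 1)) / p + ((91 * n + 2 : ℚ) - ((25 + j) * n + 1) - k) / p
      = (((41 : ℚ) - 2 * j) * n) / p := fun j => by ring
  rw [h1, h2]
  simp_rw [h3]
  ring

/-- `0 ≤ ν_{k,p}`. [cite: Zudilin2004, §8 (8.9)] -/
theorem nu_nonneg (n k p : ℕ) : 0 ≤ nu n k p := by
  rw [nu_eq_brackets]
  refine add_nonneg (mul_nonneg (by norm_num) (add_nonneg (floor_add_sub_nonneg _ _)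
    (floor_add_sub_nonneg _ _))) (sum_nonneg fun j _ => floor_add_sub_nonneg _ _)

/-- `ν_{k,p} ≤ 16`. [cite: Zudilin2004, §8 (8.9)] -/
theorem nu_le (n k p : ℕ) : nu n k p ≤ 16 := by
  rw [nu_eq_brackets]
  have hA := floor_add_sub_le_one (((k : ℚ) - (27 * n + 1)) / p) ((27 * n : ℚ) / p)
  have hB := floor_add_sub_le_one (((91 * n + 2 : ℚ) - (27 * n + 1) - k) / p) ((27 * n : ℚ) / p)
  have hC : ∑ j ∈ Icc (4 : ℕ) 13,
        (⌊((k : ℚ) - ((25 + j) * n + 1)) / p + ((91 * n + 2 : ℚ) - ((25 + j) * n + 1) - k) / p⌋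
          - ⌊((k : ℚ) - ((25 + j) * n + 1)) / p⌋
          - ⌊((91 * n + 2 : ℚ) - ((25 + j) * n + 1) - k) / p⌋) ≤ ∑ j ∈ Icc (4 : ℕ) 13, (1 : ℤ) :=
    sum_le_sum fun j _ => floor_add_sub_le_one (((k : ℚ) - ((25 + j) * n + 1)) / p)
      (((91 * n + 2 : ℚ) - ((25 + j) * n + 1) - k) / p)
  have h10 : ∑ j ∈ Icc (4 : ℕ) 13, (1 : ℤ) = 10 := by simp
  omega

/-- `0 ≤ ν_p`. [cite: Zudilin2004, §8 (8.9)] -/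
theorem nuMin_nonneg (n p : ℕ) : 0 ≤ nuMin n p := by
  unfold nuMin
  exact (Finset.le_inf'_iff _ _).2 fun k _ => nu_nonneg n k p

/-- `ν_p ≤ ν_{k,p}` for `h₄ ≤ k ≤ h₀ - h₄`. [cite: Zudilin2004, §8 (8.9)] -/
theorem nuMin_le {n p k : ℕ} (hk : k ∈ Icc (29 * n + 1) (62 * n + 1)) : nuMin n p ≤ nu n k p :=
  Finset.inf'_le _ hk

/-- `Φₙ ≥ 1`. [cite: Zudilin2004, §8 (8.8)] -/
theorem Phi_pos (n : ℕ) : 0 < Phi n := by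
  unfold Phi
  refine prod_pos fun p hp => pow_pos ?_ _
  exact (Finset.mem_filter.1 hp).2.1.pos

/-- `D_{35n}³ D_{34n} D_{33n}⁸ ≥ 1`. [folklore] -/
theorem D_pos (n : ℕ) : 0 < D n := by
  unfold D
  exact Nat.mul_pos (Nat.mul_pos (pow_pos (Nat.lcmUpto_pos _) 3) (Nat.lcmUpto_pos _))
    (pow_pos (Nat.lcmUpto_pos _) 8)

/-- **Growth of the `lcm` factor** (prime number theorem): `D_{35n}³ D_{34n} D_{33n}⁸ ≤ e^{403.1 n}`
for all large `n` ("`(d_{35n}³ d_{34n} d_{33n}⁸)^{1/n} → e^{403}`", [Fischler2004, §3.3];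
[Zudilin2004, proof of Thm. 3]: `3·35 + 34 + 8·33 = 403`). [cite: Zudilin2004, §8 proof of Thm. 3] -/
theorem eventually_D_le_exp : ∀ᶠ n : ℕ in atTop, (D n : ℝ) ≤ Real.exp ((4031 / 10) * n) := by
  have hε : (0 : ℝ) < 1 / 30 := by norm_num
  filter_upwards [eventually_lcmUpto_mul_pow_le_exp 35 3 hε, eventually_lcmUpto_mul_pow_le_exp 34 1 hε,
    eventually_lcmUpto_mul_pow_le_exp 33 8 hε] with n h35 h34 h33
  unfold D
  push_cast
  rw [pow_one] at h34
  have h0 : (0 : ℝ) ≤ (Nat.lcmUpto (35 * n) : ℝ) ^ 3 := by positivity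
  have h0' : (0 : ℝ) ≤ (Nat.lcmUpto (34 * n) : ℝ) := by positivity
  have h0'' : (0 : ℝ) ≤ (Nat.lcmUpto (33 * n) : ℝ) ^ 8 := by positivity
  calc (Nat.lcmUpto (35 * n) : ℝ) ^ 3 * (Nat.lcmUpto (34 * n) : ℝ) * (Nat.lcmUpto (33 * n) : ℝ) ^ 8
      ≤ Real.exp (((35 : ℕ) * (3 : ℕ) + 1 / 30) * n) * Real.exp (((34 : ℕ) * (1 : ℕ) + 1 / 30) * n) *
          Real.exp (((33 : ℕ) * (8 : ℕ) + 1 / 30) * n) := by gcongr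
    _ = Real.exp ((4031 / 10) * n) := by
        rw [← Real.exp_add, ← Real.exp_add]
        congr 1
        push_cast
        ring

/-! ### The gluing step of [Zudilin2004, Theorem 3] -/

/-- **Gluing step of Zudilin's theorem** ([Zudilin2004, §8, Thm. 3]; [Fischler2004, §3.3]:
"Comme `403 < 227,58 + 176,75` on obtient la conclusion cherchée"). Hypotheses, each a printed
intermediate result of the source at the parameters of Theorem 3:

* `harith` — [Zudilin2004, Lemma 19] (in the normalisation of [Fischler2004, §3.3], with the
  harmless extra factor `2`): for `n ≥ 1`, `2 D_{35n}³ D_{34n} D_{33n}⁸ Sₙ = Φₙ (a₀ + a₁ ζ(5) +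
  a₂ ζ(7) + a₃ ζ(9) + a₄ ζ(11))` with integers `aᵢ`;
* `hdecay`, `hnonvanish` — [Zudilin2004, Lemma 20] with the values of the proof of Theorem 3
  (`τ₀ = 87.47900541… + 3.32820690… i`, `limsup log|Sₙ|/n = -C₀`, `C₀ = 227.58019641…`):
  `|Sₙ| ≤ e^{-227.55 n}` for all large `n`, and `Sₙ ≠ 0` for infinitely many `n`;
* `hPhi` — the asymptotics of (8.8) ([Zudilin2004, p. 20 and Prop. 5], `C₂ = 226.24944266…`,
  i.e. `liminf log Φₙ / n ≥ 403 - C₂ = 176.75055734…`): `Φₙ ≥ e^{176.7 n}` for all large `n`.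

Conclusion: `zudilin` — one of `ζ(5), ζ(7), ζ(9), ζ(11)` is irrational — via
`eventually_D_le_exp` (`403.1`) and `exists_irrational_of_integerLinearForms`, since
`403.1 - 227.55 - 176.7 = -1.15 < 0`. [cite: Zudilin2004, §8 Thm. 3 (proof)] -/
theorem zudilin_of_linearForms
    (harith : ∀ n : ℕ, 1 ≤ n → ∃ a : Fin 5 → ℤ,
      2 * (D n : ℝ) * S n = Phi n * (a 0 + a 1 * zetaValue 5 + a 2 * zetaValue 7 +
        a 3 * zetaValue 9 + a 4 * zetaValue 11))
    (hdecay : ∀ᶠ n : ℕ in atTop, |S n| ≤ Real.exp (-(4551 / 20) * n))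
    (hnonvanish : ∃ᶠ n : ℕ in atTop, S n ≠ 0)
    (hPhi : ∀ᶠ n : ℕ in atTop, Real.exp ((1767 / 10) * n) ≤ Phi n) :
    zudilin := by
  classical
  -- the scaled forms `ℓ n = 2 Dₙ Sₙ / Φₙ`, shifted by one so that `harith` applies everywhere
  set ℓ : ℕ → ℝ := fun n => 2 * (D (n + 1) : ℝ) * S (n + 1) / Phi (n + 1) with hℓdef
  choose! a ha using harith
  -- the four candidate numbers
  set x : Fin 4 → ℝ := ![zetaValue 5, zetaValue 7, zetaValue 9, zetaValue 11] with hx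
  have hPhi_ne : ∀ n, (Phi n : ℝ) ≠ 0 := fun n => by exact_mod_cast (Phi_pos n).ne'
  have hform : ∀ n, ℓ n = (a (n + 1) 0 : ℝ) + ∑ i : Fin 4, (a (n + 1) i.succ : ℝ) * x i := by
    intro n
    have h := ha (n + 1) (Nat.succ_le_succ (Nat.zero_le n))
    rw [hℓdef]
    simp only
    rw [h, mul_div_cancel_left₀ _ (hPhi_ne (n + 1))]
    simp [hx, Fin.sum_univ_four]
    ring
  -- smallness: `|ℓ n| ≤ 2 e^{403.1 m} e^{-227.55 m} e^{-176.7 m} = 2 e^{-1.15 m}`, `m = n + 1`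
  have hbound : ∀ᶠ n : ℕ in atTop, |ℓ n| ≤ 2 * Real.exp (-(23 / 20) * ((n + 1 : ℕ) : ℝ)) := by
    have hshift : Tendsto (fun n : ℕ => n + 1) atTop atTop := tendsto_add_atTop_nat 1
    filter_upwards [hshift.eventually eventually_D_le_exp, hshift.eventually hdecay,
      hshift.eventually hPhi] with n hD hS hP
    rw [hℓdef]
    simp only
    have hPpos : (0 : ℝ) < Phi (n + 1) := by exact_mod_cast Phi_pos (n + 1)
    have hDnn : (0 : ℝ) ≤ D (n + 1) := by positivity
    rw [abs_div, abs_of_pos hPpos, div_le_iff₀ hPpos, abs_mul, abs_mul, abs_of_pos (by norm_num : (0:ℝ) < 2),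
      abs_of_nonneg hDnn]
    calc 2 * (D (n + 1) : ℝ) * |S (n + 1)|
        ≤ 2 * Real.exp ((4031 / 10) * ((n + 1 : ℕ) : ℝ)) * Real.exp (-(4551 / 20) * ((n + 1 : ℕ) : ℝ)) := by
          gcongr
      _ = 2 * Real.exp (-(23 / 20) * ((n + 1 : ℕ) : ℝ)) * Real.exp ((1767 / 10) * ((n + 1 : ℕ) : ℝ)) := by
          rw [mul_assoc, mul_assoc, ← Real.exp_add, ← Real.exp_add]
          congr 2
          ring
      _ ≤ 2 * Real.exp (-(23 / 20) * ((n + 1 : ℕ) : ℝ)) * (Phi (n + 1) : ℝ) := by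
          gcongr
  have hsmall : Tendsto ℓ atTop (𝓝 0) := by
    have h2 : Tendsto (fun n : ℕ => 2 * Real.exp (-(23 / 20) * ((n + 1 : ℕ) : ℝ))) atTop (𝓝 0) := by
      rw [show (0 : ℝ) = 2 * 0 by simp]
      refine Tendsto.const_mul 2 ?_
      refine Real.tendsto_exp_atBot.comp ?_
      have : Tendsto (fun n : ℕ => ((n + 1 : ℕ) : ℝ)) atTop atTop :=
        tendsto_natCast_atTop_atTop.comp (tendsto_add_atTop_nat 1)
      exact (tendsto_const_mul_atBot_of_neg (by norm_num : (-(23 / 20) : ℝ) < 0)).2 this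
    exact squeeze_zero_norm' (by simpa [Real.norm_eq_abs] using hbound) h2
  -- non-vanishing for infinitely many `n`
  have hne : ∃ᶠ n : ℕ in atTop, ℓ n ≠ 0 := by
    have h1 : ∃ᶠ n : ℕ in atTop, S (n + 1) ≠ 0 := by
      rw [frequently_atTop] at hnonvanish ⊢
      intro N
      obtain ⟨m, hm, hSm⟩ := hnonvanish (N + 1)
      refine ⟨m - 1, by omega, ?_⟩
      have : m - 1 + 1 = m := by omega
      rwa [this]
    refine h1.mono fun n hn => ?_
    rw [hℓdef]
    simp only
    have hDpos : (0 : ℝ) < D (n + 1) := by exact_mod_cast D_pos (n + 1)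
    exact div_ne_zero (mul_ne_zero (mul_ne_zero two_ne_zero hDpos.ne') hn) (hPhi_ne _)
  -- the criterion
  obtain ⟨i, hi⟩ := exists_irrational_of_integerLinearForms x ℓ (fun n => a (n + 1) 0)
    (fun n i => a (n + 1) i.succ) hform hsmall hne
  unfold zudilin
  fin_cases i
  · exact Or.inl (by simpa [hx] using hi)
  · exact Or.inr (Or.inl (by simpa [hx] using hi))
  · exact Or.inr (Or.inr (Or.inl (by simpa [hx] using hi)))
  · exact Or.inr (Or.inr (Or.inr (by simpa [hx] using hi)))


/-! ### The gluing step with free decay constants -/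

/-- **Growth of the `lcm` factor, every `ε`**: `D_{35n}³ D_{34n} D_{33n}⁸ ≤ e^{(403+ε) n}` for all
large `n` (prime number theorem). [cite: Zudilin2004, §8 proof of Thm. 3] -/
theorem eventually_D_le_exp_of_pos {ε : ℝ} (hε : 0 < ε) :
    ∀ᶠ n : ℕ in atTop, (D n : ℝ) ≤ Real.exp ((403 + ε) * n) := by
  have hε3 : (0 : ℝ) < ε / 3 := by positivity
  filter_upwards [eventually_lcmUpto_mul_pow_le_exp 35 3 hε3, eventually_lcmUpto_mul_pow_le_exp 34 1 hε3,
    eventually_lcmUpto_mul_pow_le_exp 33 8 hε3] with n h35 h34 h33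
  unfold D
  push_cast
  rw [pow_one] at h34
  have h0 : (0 : ℝ) ≤ (Nat.lcmUpto (35 * n) : ℝ) ^ 3 := by positivity
  have h0' : (0 : ℝ) ≤ (Nat.lcmUpto (34 * n) : ℝ) := by positivity
  have h0'' : (0 : ℝ) ≤ (Nat.lcmUpto (33 * n) : ℝ) ^ 8 := by positivity
  calc (Nat.lcmUpto (35 * n) : ℝ) ^ 3 * (Nat.lcmUpto (34 * n) : ℝ) * (Nat.lcmUpto (33 * n) : ℝ) ^ 8
      ≤ Real.exp (((35 : ℕ) * (3 : ℕ) + ε / 3) * n) * Real.exp (((34 : ℕ) * (1 : ℕ) + ε / 3) * n) *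
          Real.exp (((33 : ℕ) * (8 : ℕ) + ε / 3) * n) := by gcongr
    _ = Real.exp ((403 + ε) * n) := by
        rw [← Real.exp_add, ← Real.exp_add]
        congr 1
        push_cast
        ring

/-- **Gluing step of Zudilin's theorem with free constants** (same proof as
`zudilin_of_linearForms`): if `2 D Sₙ = Φₙ (a₀ + a₁ζ(5) + ⋯ + a₄ζ(11))` with integers `aᵢ` for
`n ≥ 1` (Lemma 19; proved in `ZudilinLinearForm.lean`), `|Sₙ| ≤ e^{-c₁ n}` for large `n` and
`Sₙ ≠ 0` infinitely often (Lemma 20: any `c₁ < C₀ = 227.58019641…`), and `Φₙ ≥ e^{c₂ n}` for large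
`n` (any `c₂ < 403 - C₂ = 176.75055734…`), with `403 < c₁ + c₂`, then one of
`ζ(5), ζ(7), ζ(9), ζ(11)` is irrational ([Zudilin2004, Prop. 5: `C₀ > C₂`]; the prime number
theorem supplies `D ≤ e^{(403+ε)n}` with `ε = (c₁ + c₂ - 403)/2`).
[cite: Zudilin2004, §8 Prop. 5 and Thm. 3 (proof)] -/
theorem zudilin_of_linearForms_of_lt {c₁ c₂ : ℝ} (hc : 403 < c₁ + c₂)
    (harith : ∀ n : ℕ, 1 ≤ n → ∃ a : Fin 5 → ℤ,
      2 * (D n : ℝ) * S n = Phi n * (a 0 + a 1 * zetaValue 5 + a 2 * zetaValue 7 +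
        a 3 * zetaValue 9 + a 4 * zetaValue 11))
    (hdecay : ∀ᶠ n : ℕ in atTop, |S n| ≤ Real.exp (-c₁ * n))
    (hnonvanish : ∃ᶠ n : ℕ in atTop, S n ≠ 0)
    (hPhi : ∀ᶠ n : ℕ in atTop, Real.exp (c₂ * n) ≤ Phi n) :
    zudilin := by
  classical
  set ε : ℝ := (c₁ + c₂ - 403) / 2 with hεdef
  have hε : 0 < ε := by rw [hεdef]; linarith
  set ℓ : ℕ → ℝ := fun n => 2 * (D (n + 1) : ℝ) * S (n + 1) / Phi (n + 1) with hℓdef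
  choose! a ha using harith
  set x : Fin 4 → ℝ := ![zetaValue 5, zetaValue 7, zetaValue 9, zetaValue 11] with hx
  have hPhi_ne : ∀ n, (Phi n : ℝ) ≠ 0 := fun n => by exact_mod_cast (Phi_pos n).ne'
  have hform : ∀ n, ℓ n = (a (n + 1) 0 : ℝ) + ∑ i : Fin 4, (a (n + 1) i.succ : ℝ) * x i := by
    intro n
    have h := ha (n + 1) (Nat.succ_le_succ (Nat.zero_le n))
    rw [hℓdef]
    simp only
    rw [h, mul_div_cancel_left₀ _ (hPhi_ne (n + 1))]
    simp [hx, Fin.sum_univ_four]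
    ring
  have hbound : ∀ᶠ n : ℕ in atTop, |ℓ n| ≤ 2 * Real.exp (-ε * ((n + 1 : ℕ) : ℝ)) := by
    have hshift : Tendsto (fun n : ℕ => n + 1) atTop atTop := tendsto_add_atTop_nat 1
    filter_upwards [hshift.eventually (eventually_D_le_exp_of_pos hε), hshift.eventually hdecay,
      hshift.eventually hPhi] with n hD hS hP
    rw [hℓdef]
    simp only
    have hPpos : (0 : ℝ) < Phi (n + 1) := by exact_mod_cast Phi_pos (n + 1)
    have hDnn : (0 : ℝ) ≤ D (n + 1) := by positivity
    rw [abs_div, abs_of_pos hPpos, div_le_iff₀ hPpos, abs_mul, abs_mul, abs_of_pos (by norm_num : (0:ℝ) < 2),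
      abs_of_nonneg hDnn]
    calc 2 * (D (n + 1) : ℝ) * |S (n + 1)|
        ≤ 2 * Real.exp ((403 + ε) * ((n + 1 : ℕ) : ℝ)) * Real.exp (-c₁ * ((n + 1 : ℕ) : ℝ)) := by
          gcongr
      _ = 2 * Real.exp (-ε * ((n + 1 : ℕ) : ℝ)) * Real.exp (c₂ * ((n + 1 : ℕ) : ℝ)) := by
          rw [mul_assoc, mul_assoc, ← Real.exp_add, ← Real.exp_add]
          congr 2
          rw [hεdef]
          ring
      _ ≤ 2 * Real.exp (-ε * ((n + 1 : ℕ) : ℝ)) * (Phi (n + 1) : ℝ) := by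
          gcongr
  have hsmall : Tendsto ℓ atTop (𝓝 0) := by
    have h2 : Tendsto (fun n : ℕ => 2 * Real.exp (-ε * ((n + 1 : ℕ) : ℝ))) atTop (𝓝 0) := by
      rw [show (0 : ℝ) = 2 * 0 by simp]
      refine Tendsto.const_mul 2 ?_
      refine Real.tendsto_exp_atBot.comp ?_
      have : Tendsto (fun n : ℕ => ((n + 1 : ℕ) : ℝ)) atTop atTop :=
        tendsto_natCast_atTop_atTop.comp (tendsto_add_atTop_nat 1)
      exact (tendsto_const_mul_atBot_of_neg (by linarith : -ε < 0)).2 this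
    exact squeeze_zero_norm' (by simpa [Real.norm_eq_abs] using hbound) h2
  have hne : ∃ᶠ n : ℕ in atTop, ℓ n ≠ 0 := by
    have h1 : ∃ᶠ n : ℕ in atTop, S (n + 1) ≠ 0 := by
      rw [frequently_atTop] at hnonvanish ⊢
      intro N
      obtain ⟨m, hm, hSm⟩ := hnonvanish (N + 1)
      refine ⟨m - 1, by omega, ?_⟩
      have : m - 1 + 1 = m := by omega
      rwa [this]
    refine h1.mono fun n hn => ?_
    rw [hℓdef]
    simp only
    have hDpos : (0 : ℝ) < D (n + 1) := by exact_mod_cast D_pos (n + 1)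
    exact div_ne_zero (mul_ne_zero (mul_ne_zero two_ne_zero hDpos.ne') hn) (hPhi_ne _)
  obtain ⟨i, hi⟩ := exists_irrational_of_integerLinearForms x ℓ (fun n => a (n + 1) 0)
    (fun n i => a (n + 1) i.succ) hform hsmall hne
  unfold zudilin
  fin_cases i
  · exact Or.inl (by simpa [hx] using hi)
  · exact Or.inr (Or.inl (by simpa [hx] using hi))
  · exact Or.inr (Or.inr (Or.inl (by simpa [hx] using hi)))
  · exact Or.inr (Or.inr (Or.inr (by simpa [hx] using hi)))

end Zudilin2004

end Literature.NumberTheory.Transcendental
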